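import Literature.Analysis.FunctionSpaces.SobolevTraceRellichProofs
import Literature.Analysis.FunctionSpaces.SobolevDomainNormProofs
import Literature.Analysis.FunctionSpaces.BallLipschitzDomain
import Mathlib.MeasureTheory.Measure.SeparableMeasure
import HarnessLib

/-!
# The Ehrling–Lions lemma on `W^{1,2}(Ω)` of a bounded Lipschitz domain (pairing form)

Analysis/FunctionSpaces theorem file (no new definitions, no named facts). The classical
**Ehrling lemma** / **Lions' lemma** (Ehrling 1954; H. W. Alt, *Linear Functional Analysis*
(2016), E10.2 "Ehrling's lemma": `‖Kx‖_Y ≤ ε ‖x‖_X + C_ε ‖TKx‖_Z` for `K` compact, `T` injective;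
J.-L. Lions, *Quelques méthodes de résolution des problèmes aux limites non linéaires* (1969),
Ch. 1, Lemme 5.1; R. Temam, *Navier–Stokes equations* (1977/79), Ch. III, §2, Lemma 2.1) for
the compact triple `W^{1,2}(Ω) ⊂⊂ L²(Ω) ⊂ 𝓓'(Ω)`:
for every `ε > 0` the `L²` norm on the unit ball of `W^{1,2}(Ω)` is controlled by `ε` plus
*finitely many* distributional pairings. It is the functional-analytic core of every
Aubin–Lions / Rellich–Lions compactness argument for evolution equations (Temam, Ch. III,
Thm. 2.1; Lemarié-Rieusset, *The Navier–Stokes problem in the 21st century*, Thm. 12.1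
"Rellich–Lions"; the compactness of suitable weak solutions of the Navier–Stokes equations,
Lin 1998, Thm. 2.2; Caffarelli–Kohn–Nirenberg 1982, Appendix), where it converts weak
convergence of a.e. time slice plus an `L²_t H¹_x` bound into strong `L²_{t,x}` convergence
(see the sequel `AubinLionsSlices`).

Let `E'` be a finite-dimensional real inner product space with Lebesgue (additive Haar) measure
`μ`, `Ω ⊆ E'` a bounded Lipschitz domain (accepted `IsLipschitzDomain`, e.g. a ball,
`isLipschitzDomain_ball`), `F` a finite-dimensional real normed space. Main results:

* `exists_seq_isTestFunctionOn_dense` — a sequence of real test functions on an open `Ω` which is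
  `L²(Ω, μ)`-dense in the set of all real test functions on `Ω` (separability of `L²`);
  `ae_eq_zero_of_forall_setIntegral_smul_seq_eq_zero` — such a sequence separates `L²(Ω; F)`:
  `∫_Ω dⱼ • f = 0` for all `j` forces `f = 0` a.e. on `Ω`.
* `ehrling_unit` — **Ehrling's lemma, inhomogeneous form**: for `ε > 0` there are finitely many
  real test functions `φ₁, …, φₙ ∈ C_c^∞(Ω)` with
  `‖w‖²_{L²(Ω)} ≤ ε + Σᵢ ‖∫_Ω φᵢ • w‖²` for every `w ∈ W^{1,2}(Ω; F)` with `‖w‖_{L²(Ω)} ≤ 1` and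
  weak derivative `‖Dw‖_{L²(Ω)} ≤ 1` (contradiction + the tree's Rellich–Kondrachov theorem
  `exists_subseq_tendsto_eLpNorm_of_isLipschitzDomain` + separation);
* `ehrling` — **Ehrling's lemma, homogeneous form**:
  `‖w‖²_{L²(Ω)} ≤ ε (‖w‖²_{L²(Ω)} + ‖Dw‖²_{L²(Ω)}) + Σᵢ ‖∫_Ω φᵢ • w‖²` for *every* `w` with a weak
  derivative `Dw` on `Ω` (stated in `ℝ≥0∞`, so no integrability hypotheses are needed);
* `ehrling_ball` — the case of a ball.

The pairings are against *scalar* test functions (`∫_Ω φ • w ∈ F`), the form produced by weak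
formulations of PDE and consumed by Mathlib's separation lemma
`IsOpen.ae_eq_zero_of_integral_contDiff_smul_eq_zero`; no inner product on `F` is needed.

## Proof of `ehrling_unit`

If the conclusion fails for some `ε > 0`, apply its negation to the families
`((N+1) dⱼ)_{j<N}`, `(dⱼ)` the dense sequence: this gives `w_N` with weak derivative `g_N`,
`‖w_N‖₂ ≤ 1`, `‖g_N‖₂ ≤ 1`, `ε < ‖w_N‖₂²` and `‖∫_Ω dⱼ • w_N‖ < 1/(N+1)` for `j < N`. By
Rellich–Kondrachov a subsequence converges in `L²(Ω)` to some `f`; then `‖f‖₂² ≥ ε` while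
`∫_Ω dⱼ • f = 0` for every `j`, so `f = 0` a.e. — a contradiction (Alt 2016, solution of
E10.2, with `K : W^{1,2}(Ω) → L²(Ω)` the Rellich embedding and `T` the injection of `L²(Ω)` into
the countable product of the pairings with `(dⱼ)`; Temam, Ch. III, proof of Lemma 2.1).

## Mathlib / tree search

Mathlib (this pin) has no weak derivatives, no Rellich theorem and no Ehrling lemma (searched
`Ehrling`, `Friedrichs`, `Aubin`, `compact embedding` in `Analysis`, `MeasureTheory`); used:
`Lp.SecondCountableTopology`, `TopologicalSpace.IsSeparable.exists_countable_dense_subset`,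
`IsOpen.ae_eq_zero_of_integral_contDiff_smul_eq_zero`, `eLpNorm_smul_le_mul_eLpNorm`. From the
tree: `HasWeakFDerivOn` (`SobolevDomain`), `HasWeakFDerivOn.const_smul`
(`SobolevDomainNormProofs`), `exists_subseq_tendsto_eLpNorm_of_isLipschitzDomain`
(`SobolevTraceRellichProofs`), `isLipschitzDomain_ball` (`BallLipschitzDomain`). The tree had
no Ehrling/Friedrichs-type inequality on domains (searched `Ehrling`, `Friedrichs`, `finite
rank`, `Aubin` in `Literature/Analysis`).

## References

* H. W. Alt, *Linear Functional Analysis*, Universitext (Springer, 2016), E10.2 "Ehrling's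
  lemma" (with solution), p. 331 of the held text. [Alt2016]
* G. Ehrling, *On a type of eigenvalue problems for certain elliptic differential operators*,
  Math. Scand. 2 (1954), 267–285.
* J.-L. Lions, *Quelques méthodes de résolution des problèmes aux limites non linéaires*
  (Dunod, 1969), Ch. 1, §5.2, Lemme 5.1.
* R. Temam, *Navier–Stokes equations. Theory and numerical analysis* (North-Holland, 1977;
  rev. ed. 1979), Ch. III, §2, Lemma 2.1 and Thm. 2.1. [Temam1979]
* P. G. Lemarié-Rieusset, *The Navier–Stokes problem in the 21st century* (CRC, 2016), §12.1,
  Thm. 12.1 (Rellich–Lions), p. 355. [Lemarierieusset2016]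
-/

noncomputable section

open MeasureTheory TopologicalSpace Set Function Filter Topology Metric Bornology
open scoped ENNReal NNReal

namespace Literature.Analysis.FunctionSpaces

/-! ### Test functions: two closure properties (kept local to avoid heavy imports) -/

section TestFunctions

variable {X : Type*} [NormedAddCommGroup X] [NormedSpace ℝ X]
variable {G : Type*} [NormedAddCommGroup G] [NormedSpace ℝ G]

/-- Constant multiples of test functions are test functions. [folklore] -/
theorem Ehrling.isTestFunctionOn_const_smul {Ω : Opens X} {φ : X → G}
    (hφ : IsTestFunctionOn Ω φ) (c : ℝ) : IsTestFunctionOn Ω (c • φ) :=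
  ⟨contDiff_const.smul hφ.contDiff, hφ.hasCompactSupport.smul_left,
    (tsupport_smul_subset_right (fun _ : X => c) φ).trans hφ.tsupport_subset⟩

/-- A test function is bounded. [folklore] -/
theorem Ehrling.exists_norm_le_of_isTestFunctionOn {Ω : Opens X} {φ : X → G}
    (hφ : IsTestFunctionOn Ω φ) : ∃ C : ℝ, 0 ≤ C ∧ ∀ x, ‖φ x‖ ≤ C := by
  obtain ⟨C, hC⟩ := (hφ.contDiff.continuous.norm).bddAbove_range_of_hasCompactSupport
    hφ.hasCompactSupport.norm
  exact ⟨max C 0, le_max_right _ _, fun x => (hC ⟨x, rfl⟩).trans (le_max_left _ _)⟩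

end TestFunctions

/-! ### Pairings with test functions: integrability and the Cauchy–Schwarz bound -/

section Pairing

variable {X : Type*} [NormedAddCommGroup X] [NormedSpace ℝ X] [MeasurableSpace X]
  [OpensMeasurableSpace X]
variable {F : Type*} [NormedAddCommGroup F] [NormedSpace ℝ F]

/-- A test function lies in `L^∞(Ω, μ)`. [folklore] -/
theorem Ehrling.memLp_top_of_isTestFunctionOn {Ω : Opens X} {φ : X → ℝ}
    (hφ : IsTestFunctionOn Ω φ) (ν : Measure X) : MemLp φ ∞ ν := by
  obtain ⟨C, -, hC⟩ := Ehrling.exists_norm_le_of_isTestFunctionOn hφ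
  exact memLp_top_of_bound hφ.contDiff.continuous.aestronglyMeasurable C
    (Eventually.of_forall hC)

/-- A test function lies in `L²(ν)` for every measure finite on compact sets. [folklore] -/
theorem Ehrling.memLp_two_of_isTestFunctionOn {Ω : Opens X} {φ : X → ℝ}
    (hφ : IsTestFunctionOn Ω φ) (ν : Measure X) [IsFiniteMeasureOnCompacts ν] : MemLp φ 2 ν :=
  hφ.contDiff.continuous.memLp_of_hasCompactSupport hφ.hasCompactSupport

/-- `φ • w` is integrable on a set of finite measure when `φ` is a test function and
`w ∈ L²`. [folklore] -/
theorem Ehrling.integrable_smul_of_memLp_two {Ω : Opens X} {φ : X → ℝ}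
    (hφ : IsTestFunctionOn Ω φ) {ν : Measure X} [IsFiniteMeasure ν] {w : X → F}
    (hw : MemLp w 2 ν) : Integrable (fun x => φ x • w x) ν := by
  have h1 : Integrable w ν := memLp_one_iff_integrable.1 (hw.mono_exponent one_le_two)
  exact h1.smul_of_top_right (Ehrling.memLp_top_of_isTestFunctionOn hφ ν)

end Pairing

/-! ### The Cauchy–Schwarz bound for pairings -/

section CauchySchwarz

variable {α : Type*} [MeasurableSpace α]
variable {F : Type*} [NormedAddCommGroup F] [NormedSpace ℝ F]

/-- **Cauchy–Schwarz for the pairing**: `‖∫ φ • w dν‖ ≤ ‖φ‖_{L²(ν)} ‖w‖_{L²(ν)}`. [folklore] -/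
theorem Ehrling.enorm_integral_smul_le {φ : α → ℝ} {w : α → F} {ν : Measure α}
    (hφ : AEStronglyMeasurable φ ν) (hw : AEStronglyMeasurable w ν) :
    ‖∫ x, φ x • w x ∂ν‖ₑ ≤ eLpNorm φ 2 ν * eLpNorm w 2 ν := by
  calc ‖∫ x, φ x • w x ∂ν‖ₑ ≤ ∫⁻ x, ‖φ x • w x‖ₑ ∂ν := enorm_integral_le_lintegral_enorm _
    _ = eLpNorm (φ • w) 1 ν := by rw [eLpNorm_one_eq_lintegral_enorm]; rfl
    _ ≤ eLpNorm φ 2 ν * eLpNorm w 2 ν := eLpNorm_smul_le_mul_eLpNorm hw hφ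

end CauchySchwarz

/-! ### A dense sequence of test functions and the separation property -/

section Dense

variable {X : Type*} [NormedAddCommGroup X] [NormedSpace ℝ X] [FiniteDimensional ℝ X]
  [MeasurableSpace X] [BorelSpace X]

/-- **A sequence of test functions dense in `L²`.** For an open `Ω` and a measure `ν`, locally
finite and s-finite, there is a sequence `(dⱼ)` of real test functions on `Ω` such that every
real test function on `Ω` is an `L²(Ω, ν)`-limit of members of the sequence: `L²(Ω, ν)` is
second countable, so the image of `C_c^∞(Ω)` in it has a countable dense subset. [folklore] -/
theorem exists_seq_isTestFunctionOn_dense (Ω : Opens X) (ν : Measure X)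
    [IsLocallyFiniteMeasure ν] [SFinite ν] :
    ∃ d : ℕ → X → ℝ, (∀ j, IsTestFunctionOn Ω (d j)) ∧
      ∀ g : X → ℝ, IsTestFunctionOn Ω g → ∀ ε : ℝ≥0∞, ε ≠ 0 →
        ∃ j, eLpNorm (g - d j) 2 (ν.restrict Ω) < ε := by
  haveI : Fact ((1 : ℝ≥0∞) ≤ 2) := ⟨one_le_two⟩
  haveI : Fact ((2 : ℝ≥0∞) ≠ ∞) := ⟨ENNReal.ofNat_ne_top⟩
  set νΩ : Measure X := ν.restrict (Ω : Set X) with hνΩ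
  have hmem : ∀ {g : X → ℝ}, IsTestFunctionOn Ω g → MemLp g 2 νΩ := fun hg =>
    (Ehrling.memLp_two_of_isTestFunctionOn hg ν).restrict _
  -- the image of the test functions in `L²(Ω, ν)`
  set T : Set (X → ℝ) := {g | IsTestFunctionOn Ω g} with hT
  set Φ : T → Lp ℝ 2 νΩ := fun g => (hmem g.2).toLp (g : X → ℝ) with hΦ
  set R : Set (Lp ℝ 2 νΩ) := range Φ with hR
  have hsep : IsSeparable R := IsSeparable.of_separableSpace R
  obtain ⟨c, hcR, hcc, hRc⟩ := hsep.exists_countable_dense_subset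
  have h0T : (0 : X → ℝ) ∈ T := isTestFunctionOn_zero Ω
  have hcne : c.Nonempty := by
    by_contra h
    rw [not_nonempty_iff_eq_empty] at h
    have : Φ ⟨0, h0T⟩ ∈ closure c := hRc (mem_range_self _)
    rw [h, closure_empty] at this
    exact this
  obtain ⟨e, he⟩ := hcc.exists_eq_range hcne
  have hpre : ∀ j, ∃ g : T, Φ g = e j := fun j => hcR (he ▸ mem_range_self j)
  choose g hg using hpre
  refine ⟨fun j => (g j : X → ℝ), fun j => (g j).2, fun f hf ε hε => ?_⟩
  have hfc : Φ ⟨f, hf⟩ ∈ closure c := hRc (mem_range_self _)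
  obtain ⟨y, hyc, hy⟩ := EMetric.mem_closure_iff.1 hfc ε (pos_iff_ne_zero.2 hε)
  obtain ⟨j, rfl⟩ : ∃ j, e j = y := by rw [he] at hyc; exact hyc
  refine ⟨j, ?_⟩
  rw [← hg j, hΦ, Lp.edist_toLp_toLp] at hy
  exact hy

/-- **Separation by a dense sequence of test functions.** If `(dⱼ)` is `L²(Ω, ν)`-dense in the
real test functions on `Ω` (as furnished by `exists_seq_isTestFunctionOn_dense`) and
`f ∈ L²(Ω, ν; F)` satisfies `∫_Ω dⱼ • f dν = 0` for every `j`, then `f = 0` a.e. on `Ω`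
(pass to arbitrary test functions by Cauchy–Schwarz, then Mathlib's
`IsOpen.ae_eq_zero_of_integral_contDiff_smul_eq_zero`). [folklore] -/
theorem ae_eq_zero_of_forall_setIntegral_smul_seq_eq_zero {Ω : Opens X} {ν : Measure X}
    [IsLocallyFiniteMeasure ν] {d : ℕ → X → ℝ} (hd : ∀ j, IsTestFunctionOn Ω (d j))
    (hdense : ∀ g : X → ℝ, IsTestFunctionOn Ω g → ∀ ε : ℝ≥0∞, ε ≠ 0 →
      ∃ j, eLpNorm (g - d j) 2 (ν.restrict Ω) < ε)
    {F : Type*} [NormedAddCommGroup F] [NormedSpace ℝ F] [CompleteSpace F]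
    {f : X → F} (hf : MemLp f 2 (ν.restrict Ω))
    (h0 : ∀ j, ∫ x in (Ω : Set X), d j x • f x ∂ν = 0) :
    f =ᵐ[ν.restrict Ω] 0 := by
  set νΩ : Measure X := ν.restrict (Ω : Set X) with hνΩ
  have hli : LocallyIntegrableOn f (Ω : Set X) νΩ :=
    (hf.locallyIntegrable one_le_two).locallyIntegrableOn _
  have key : ∀ g : X → ℝ, ContDiff ℝ (⊤ : ℕ∞) g → HasCompactSupport g →
      tsupport g ⊆ (Ω : Set X) → ∫ x, g x • f x ∂νΩ = 0 := by
    intro g hg hgc hgΩ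
    have hgT : IsTestFunctionOn Ω g := ⟨hg, hgc, hgΩ⟩
    -- `‖∫ g • f‖ ≤ ‖g - d j‖₂ ‖f‖₂ < ε ‖f‖₂` for suitable `j`, for every `ε > 0`
    have hbound : ∀ n : ℕ, ‖∫ x, g x • f x ∂νΩ‖ₑ ≤ ((n : ℝ≥0∞) + 1)⁻¹ * eLpNorm f 2 νΩ := by
      intro n
      have hne : ((n : ℝ≥0∞) + 1)⁻¹ ≠ 0 := ENNReal.inv_ne_zero.2 (by simp)
      obtain ⟨j, hj⟩ := hdense g hgT _ hne
      have hdT := hd j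
      have hint_g : Integrable (fun x => g x • f x) νΩ := by
        have hgm := Ehrling.memLp_top_of_isTestFunctionOn hgT νΩ
        have h2 : MemLp (fun x => g x • f x) 2 νΩ := hf.smul hgm
        -- supported in the compact `tsupport g`, where the measure is finite
        have hsupp : support (fun x => g x • f x) ⊆ tsupport g := fun x hx => by
          by_contra h
          exact hx (by simp only [image_eq_zero_of_notMem_tsupport h, zero_smul])
        have h2' : MemLp (fun x => g x • f x) 2 (νΩ.restrict (tsupport g)) := h2.restrict _
        haveI : IsFiniteMeasure (νΩ.restrict (tsupport g)) := by
          refine ⟨?_⟩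
          rw [Measure.restrict_apply_univ]
          exact hgc.isCompact.measure_lt_top
        have h1 : Integrable (fun x => g x • f x) (νΩ.restrict (tsupport g)) :=
          memLp_one_iff_integrable.1 (h2'.mono_exponent one_le_two)
        exact (integrableOn_iff_integrable_of_support_subset hsupp).1 h1
      have hint_d : Integrable (fun x => d j x • f x) νΩ := by
        have hdm := Ehrling.memLp_top_of_isTestFunctionOn hdT νΩ
        have h2 : MemLp (fun x => d j x • f x) 2 νΩ := hf.smul hdm
        have hsupp : support (fun x => d j x • f x) ⊆ tsupport (d j) := fun x hx => by
          by_contra h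
          exact hx (by simp only [image_eq_zero_of_notMem_tsupport h, zero_smul])
        have h2' : MemLp (fun x => d j x • f x) 2 (νΩ.restrict (tsupport (d j))) :=
          h2.restrict _
        haveI : IsFiniteMeasure (νΩ.restrict (tsupport (d j))) := by
          refine ⟨?_⟩
          rw [Measure.restrict_apply_univ]
          exact hdT.hasCompactSupport.isCompact.measure_lt_top
        have h1 : Integrable (fun x => d j x • f x) (νΩ.restrict (tsupport (d j))) :=
          memLp_one_iff_integrable.1 (h2'.mono_exponent one_le_two)
        exact (integrableOn_iff_integrable_of_support_subset hsupp).1 h1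
      have hsub : ∫ x, g x • f x ∂νΩ = ∫ x, (g - d j) x • f x ∂νΩ := by
        have : ∫ x, (g - d j) x • f x ∂νΩ = ∫ x, g x • f x ∂νΩ - ∫ x, d j x • f x ∂νΩ := by
          rw [← integral_sub hint_g hint_d]
          refine integral_congr_ae (Eventually.of_forall fun x => ?_)
          simp only [Pi.sub_apply, sub_smul]
        rw [this, h0 j, sub_zero]
      rw [hsub]
      calc ‖∫ x, (g - d j) x • f x ∂νΩ‖ₑ ≤ eLpNorm (g - d j) 2 νΩ * eLpNorm f 2 νΩ :=
            Ehrling.enorm_integral_smul_le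
              ((hgT.contDiff.continuous.sub hdT.contDiff.continuous).aestronglyMeasurable) hf.1
        _ ≤ ((n : ℝ≥0∞) + 1)⁻¹ * eLpNorm f 2 νΩ := mul_le_mul' hj.le le_rfl
    have hlim : Tendsto (fun n : ℕ => ((n : ℝ≥0∞) + 1)⁻¹ * eLpNorm f 2 νΩ) atTop (𝓝 0) := by
      have h1 : Tendsto (fun n : ℕ => ((n : ℝ≥0∞) + 1)⁻¹) atTop (𝓝 0) := by
        have := ENNReal.tendsto_inv_nat_nhds_zero.comp (tendsto_add_atTop_nat 1)
        refine this.congr fun n => ?_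
        simp [Function.comp]
      simpa using ENNReal.Tendsto.mul_const h1 (Or.inr hf.eLpNorm_ne_top)
    have h0' : ‖∫ x, g x • f x ∂νΩ‖ₑ ≤ 0 := ge_of_tendsto' hlim hbound
    simpa using h0'
  have h := Ω.isOpen.ae_eq_zero_of_integral_contDiff_smul_eq_zero (μ := νΩ) hli key
  filter_upwards [h, ae_restrict_mem Ω.isOpen.measurableSet] with x hx hxΩ using hx hxΩ

end Dense

/-! ### Ehrling's lemma -/

section Ehrling

variable {E' : Type*} [NormedAddCommGroup E'] [InnerProductSpace ℝ E'] [MeasurableSpace E']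
  [BorelSpace E'] [FiniteDimensional ℝ E']
variable {F : Type*} [NormedAddCommGroup F] [NormedSpace ℝ F] [FiniteDimensional ℝ F]

/-- **Ehrling's lemma (Lions' lemma), inhomogeneous form on the unit ball of `W^{1,2}(Ω)`.**
Let `Ω` be a bounded Lipschitz domain of a finite-dimensional real inner product space with
additive Haar measure `μ`, and `F` a finite-dimensional real normed space. For every `ε > 0`
there are finitely many real test functions `φ₁, …, φₙ ∈ C_c^∞(Ω)` such that
`‖w‖²_{L²(Ω)} ≤ ε + Σᵢ ‖∫_Ω φᵢ • w dμ‖²` for every `w : E' → F` having a weak derivative `g`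
on `Ω` with `‖w‖_{L²(Ω)} ≤ 1` and `‖g‖_{L²(Ω)} ≤ 1` (J.-L. Lions 1969, Ch. 1, Lemme 5.1 and
Temam 1977, Ch. III, Lemma 2.1, for the compact triple `W^{1,2}(Ω) ⊂ L²(Ω) ⊂ 𝓓'(Ω)`, the
seminorm of `𝓓'(Ω)` being realised by finitely many pairings; compactness of the first
inclusion is the tree's Rellich–Kondrachov theorem
`exists_subseq_tendsto_eLpNorm_of_isLipschitzDomain`). Proof by contradiction, see the file
docstring. [cite: Alt2016, E10.2 (Ehrling's lemma)] [cite: Temam1979, Ch. III §2 Lemma 2.1] -/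
theorem ehrling_unit {Ω : Opens E'} (hΩ : IsLipschitzDomain Ω) (hb : IsBounded (Ω : Set E'))
    (μ : Measure E') [μ.IsAddHaarMeasure] {ε : ℝ≥0∞} (hε : ε ≠ 0) :
    ∃ (n : ℕ) (φ : Fin n → E' → ℝ), (∀ i, IsTestFunctionOn Ω (φ i)) ∧
      ∀ (w : E' → F) (g : E' → E' →L[ℝ] F), HasWeakFDerivOn Ω μ w g →
        eLpNorm w 2 (μ.restrict Ω) ≤ 1 → eLpNorm g 2 (μ.restrict Ω) ≤ 1 →
        eLpNorm w 2 (μ.restrict Ω) ^ 2 ≤ ε + ∑ i, ‖∫ x in (Ω : Set E'), φ i x • w x ∂μ‖ₑ ^ 2 := by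
  haveI : CompleteSpace F := FiniteDimensional.complete ℝ F
  set μΩ : Measure E' := μ.restrict (Ω : Set E') with hμΩ
  have hΩm : MeasurableSet (Ω : Set E') := Ω.isOpen.measurableSet
  have hμΩfin : μ (Ω : Set E') < ⊤ :=
    (measure_mono subset_closure).trans_lt hb.isCompact_closure.measure_lt_top
  haveI : IsFiniteMeasure μΩ := ⟨by rwa [hμΩ, Measure.restrict_apply_univ]⟩
  by_contra H
  simp only [not_exists, not_and, not_forall, not_le, exists_prop] at H
  -- the dense sequence and the families `((N+1) dⱼ)_{j<N}`
  obtain ⟨d, hd, hdense⟩ := exists_seq_isTestFunctionOn_dense Ω μ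
  set fam : (N : ℕ) → Fin N → E' → ℝ := fun N i => ((N : ℝ) + 1) • d i with hfam
  have hfamT : ∀ N (i : Fin N), IsTestFunctionOn Ω (fam N i) := fun N i =>
    Ehrling.isTestFunctionOn_const_smul (hd i) _
  choose w g hw hw1 hg1 hlt using fun N => H N (fam N) (hfamT N)
  -- consequences of the failed inequalities
  have hεw : ∀ N, ε < eLpNorm (w N) 2 μΩ ^ 2 := fun N =>
    lt_of_le_of_lt le_self_add (hlt N)
  have hpair : ∀ N (j : ℕ), j < N →
      ‖∫ x in (Ω : Set E'), d j x • w N x ∂μ‖ₑ < ((N : ℝ≥0∞) + 1)⁻¹ := by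
    intro N j hj
    have h1 : ∑ i, ‖∫ x in (Ω : Set E'), fam N i x • w N x ∂μ‖ₑ ^ 2 < 1 :=
      lt_of_le_of_lt le_add_self ((hlt N).trans_le ((pow_le_one₀ zero_le (hw1 N))))
    have h2 : ‖∫ x in (Ω : Set E'), fam N ⟨j, hj⟩ x • w N x ∂μ‖ₑ ^ 2 < 1 :=
      lt_of_le_of_lt (Finset.single_le_sum (f := fun i =>
        ‖∫ x in (Ω : Set E'), fam N i x • w N x ∂μ‖ₑ ^ 2) (fun i _ => zero_le)
        (Finset.mem_univ _)) h1
    have h3 : ‖∫ x in (Ω : Set E'), fam N ⟨j, hj⟩ x • w N x ∂μ‖ₑ < 1 := by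
      by_contra h4
      rw [not_lt] at h4
      exact absurd (one_le_pow_of_one_le' h4 2) (not_le.2 h2)
    have hsc : ∫ x in (Ω : Set E'), fam N ⟨j, hj⟩ x • w N x ∂μ =
        ((N : ℝ) + 1) • ∫ x in (Ω : Set E'), d j x • w N x ∂μ := by
      rw [← integral_smul]
      refine integral_congr_ae (Eventually.of_forall fun x => ?_)
      simp only [hfam, Pi.smul_apply, smul_eq_mul, mul_smul]
    rw [hsc, enorm_smul] at h3
    have hN : ‖((N : ℝ) + 1)‖ₑ = (N : ℝ≥0∞) + 1 := by
      rw [Real.enorm_eq_ofReal (by positivity), ENNReal.ofReal_add (by positivity) zero_le_one,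
        ENNReal.ofReal_natCast, ENNReal.ofReal_one]
    rw [hN] at h3
    have hNne : (N : ℝ≥0∞) + 1 ≠ 0 := by simp
    have hNtop : (N : ℝ≥0∞) + 1 ≠ ⊤ := by simp
    calc ‖∫ x in (Ω : Set E'), d j x • w N x ∂μ‖ₑ
        = ((N : ℝ≥0∞) + 1)⁻¹ * (((N : ℝ≥0∞) + 1) * ‖∫ x in (Ω : Set E'), d j x • w N x ∂μ‖ₑ) := by
          rw [← mul_assoc, ENNReal.inv_mul_cancel hNne hNtop, one_mul]
      _ < ((N : ℝ≥0∞) + 1)⁻¹ * 1 :=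
          (ENNReal.mul_lt_mul_iff_right (ENNReal.inv_ne_zero.2 hNtop)
            (ENNReal.inv_ne_top.2 hNne)).2 h3
      _ = ((N : ℝ≥0∞) + 1)⁻¹ := mul_one _
  -- Rellich–Kondrachov: a subsequence converges in `L²(Ω)`
  have hwm : ∀ N, AEStronglyMeasurable (w N) μΩ := fun N =>
    (hw N).locallyIntegrableOn.aestronglyMeasurable
  have hgm : ∀ N, AEStronglyMeasurable (g N) μΩ := fun N =>
    (hw N).locallyIntegrableOn_deriv.aestronglyMeasurable
  have hup : ∀ N, MemLp (w N) 2 μΩ := fun N =>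
    ⟨hwm N, (hw1 N).trans_lt ENNReal.one_lt_top⟩
  have hgp : ∀ N, MemLp (g N) 2 μΩ := fun N =>
    ⟨hgm N, (hg1 N).trans_lt ENNReal.one_lt_top⟩
  obtain ⟨f, ψ, hψ, hf, hlim⟩ := RellichDomain.exists_subseq_tendsto_eLpNorm_of_isLipschitzDomain hΩ hb
    (p := 2) (by norm_num) μ w g hw hup hgp ENNReal.one_ne_top ENNReal.one_ne_top hw1 hg1
  -- (a) `‖f‖₂² ≥ ε`
  have hfε : ε ≤ eLpNorm f 2 μΩ ^ 2 := by
    have htri : ∀ n, eLpNorm (w (ψ n)) 2 μΩ ≤ eLpNorm f 2 μΩ + eLpNorm (w (ψ n) - f) 2 μΩ := by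
      intro n
      have e : w (ψ n) = f + (w (ψ n) - f) := by abel
      calc eLpNorm (w (ψ n)) 2 μΩ = eLpNorm (f + (w (ψ n) - f)) 2 μΩ := by rw [← e]
        _ ≤ eLpNorm f 2 μΩ + eLpNorm (w (ψ n) - f) 2 μΩ :=
          eLpNorm_add_le hf.1 ((hup _).sub hf).1 one_le_two
    have hT : Tendsto (fun n => (eLpNorm f 2 μΩ + eLpNorm (w (ψ n) - f) 2 μΩ) ^ 2) atTop
        (𝓝 (eLpNorm f 2 μΩ ^ 2)) := by
      have h1 : Tendsto (fun n => eLpNorm f 2 μΩ + eLpNorm (w (ψ n) - f) 2 μΩ) atTop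
          (𝓝 (eLpNorm f 2 μΩ)) := by
        simpa using tendsto_const_nhds.add hlim
      exact ((ENNReal.continuous_pow 2).tendsto _).comp h1
    refine ge_of_tendsto' hT fun n => ?_
    exact ((hεw (ψ n)).trans_le (pow_le_pow_left' (htri n) 2)).le
  -- (b) `∫_Ω dⱼ • f = 0` for every `j`
  have hf0 : ∀ j, ∫ x in (Ω : Set E'), d j x • f x ∂μ = 0 := by
    intro j
    have hbound : ∀ n, ‖∫ x in (Ω : Set E'), d j x • f x ∂μ‖ₑ ≤
        ((n + j : ℕ) + 1 : ℝ≥0∞)⁻¹ +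
          eLpNorm (d j) 2 μΩ * eLpNorm (w (ψ (n + (j + 1))) - f) 2 μΩ := by
      intro n
      have hle : n + (j + 1) ≤ ψ (n + (j + 1)) := hψ.id_le _
      set N := ψ (n + (j + 1)) with hN
      have hjN : j < N := by omega
      have hNge : n + j + 1 ≤ N := by omega
      have hint_f : Integrable (fun x => d j x • f x) μΩ :=
        Ehrling.integrable_smul_of_memLp_two (hd j) hf
      have hint_w : Integrable (fun x => d j x • w N x) μΩ :=
        Ehrling.integrable_smul_of_memLp_two (hd j) (hup N)
      have hsplit : ∫ x in (Ω : Set E'), d j x • f x ∂μ =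
          ∫ x in (Ω : Set E'), d j x • w N x ∂μ -
            ∫ x in (Ω : Set E'), d j x • (w N x - f x) ∂μ := by
        have : ∫ x in (Ω : Set E'), d j x • (w N x - f x) ∂μ =
            ∫ x in (Ω : Set E'), d j x • w N x ∂μ - ∫ x in (Ω : Set E'), d j x • f x ∂μ := by
          rw [← integral_sub hint_w hint_f]
          refine integral_congr_ae (Eventually.of_forall fun x => ?_)
          simp only [smul_sub]
        rw [this]; abel
      rw [hsplit]
      calc ‖∫ x in (Ω : Set E'), d j x • w N x ∂μ -
              ∫ x in (Ω : Set E'), d j x • (w N x - f x) ∂μ‖ₑ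
          ≤ ‖∫ x in (Ω : Set E'), d j x • w N x ∂μ‖ₑ +
              ‖∫ x in (Ω : Set E'), d j x • (w N x - f x) ∂μ‖ₑ := enorm_sub_le
        _ ≤ ((N : ℝ≥0∞) + 1)⁻¹ + eLpNorm (d j) 2 μΩ * eLpNorm (w N - f) 2 μΩ := by
            gcongr
            · exact (hpair N j hjN).le
            · exact Ehrling.enorm_integral_smul_le
                (hd j).contDiff.continuous.aestronglyMeasurable ((hup N).sub hf).1
        _ ≤ ((n + j : ℕ) + 1 : ℝ≥0∞)⁻¹ + eLpNorm (d j) 2 μΩ * eLpNorm (w N - f) 2 μΩ := by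
            gcongr ?_ + _
            apply ENNReal.inv_le_inv.2
            gcongr
            exact_mod_cast (by omega : n + j ≤ N)
    have hlim' : Tendsto (fun n : ℕ => ((n + j : ℕ) + 1 : ℝ≥0∞)⁻¹ +
        eLpNorm (d j) 2 μΩ * eLpNorm (w (ψ (n + (j + 1))) - f) 2 μΩ) atTop (𝓝 0) := by
      have h1 : Tendsto (fun n : ℕ => ((n + j : ℕ) + 1 : ℝ≥0∞)⁻¹) atTop (𝓝 0) := by
        have := ENNReal.tendsto_inv_nat_nhds_zero.comp
          ((tendsto_add_atTop_nat 1).comp (tendsto_add_atTop_nat j))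
        refine this.congr fun n => ?_
        simp [Function.comp]
      have h2 : Tendsto (fun n : ℕ => eLpNorm (d j) 2 μΩ *
          eLpNorm (w (ψ (n + (j + 1))) - f) 2 μΩ) atTop (𝓝 0) := by
        have h3 := hlim.comp (tendsto_add_atTop_nat (j + 1))
        have h4 := ENNReal.Tendsto.const_mul h3
          (Or.inr (Ehrling.memLp_two_of_isTestFunctionOn (hd j) μ |>.restrict
            (Ω : Set E')).eLpNorm_ne_top)
        simpa using h4
      simpa using h1.add h2
    have h0 : ‖∫ x in (Ω : Set E'), d j x • f x ∂μ‖ₑ ≤ 0 := ge_of_tendsto' hlim' hbound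
    simpa using h0
  -- (c) separation: `f = 0` a.e. on `Ω`, contradicting (a)
  have hfz : f =ᵐ[μΩ] 0 := ae_eq_zero_of_forall_setIntegral_smul_seq_eq_zero hd hdense hf hf0
  have : eLpNorm f 2 μΩ = 0 := by rw [eLpNorm_congr_ae hfz, eLpNorm_zero]
  rw [this, zero_pow two_ne_zero] at hfε
  exact hε (le_antisymm hfε zero_le)

/-- **Ehrling's lemma (Lions' lemma), homogeneous form.** Let `Ω` be a bounded Lipschitz domain
of a finite-dimensional real inner product space with additive Haar measure `μ`, `F` a
finite-dimensional real normed space. For every `ε > 0` there are finitely many real test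
functions `φ₁, …, φₙ ∈ C_c^∞(Ω)` such that for every `w : E' → F` with a weak derivative `g`
on `Ω`,
`‖w‖²_{L²(Ω)} ≤ ε (‖w‖²_{L²(Ω)} + ‖g‖²_{L²(Ω)}) + Σᵢ ‖∫_Ω φᵢ • w dμ‖²`
(in `ℝ≥0∞`; both sides are `∞` unless `w, g ∈ L²(Ω)`). This is "for all `η > 0` there is
`c_η` with `‖v‖_{L²} ≤ η ‖v‖_{H¹} + c_η ‖v‖_{𝓓'}`" (J.-L. Lions 1969, Ch. 1, Lemme 5.1; Temam
1977, Ch. III, Lemma 2.1, with `X₀ = H¹(Ω)`, `X = L²(Ω)`), the weak seminorm realised by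
finitely many pairings, obtained from `ehrling_unit` by scaling. [cite: Alt2016, E10.2 (Ehrling's lemma)] [cite: Temam1979, Ch. III §2 Lemma 2.1] -/
theorem ehrling {Ω : Opens E'} (hΩ : IsLipschitzDomain Ω) (hb : IsBounded (Ω : Set E'))
    (μ : Measure E') [μ.IsAddHaarMeasure] {ε : ℝ≥0∞} (hε : ε ≠ 0) :
    ∃ (n : ℕ) (φ : Fin n → E' → ℝ), (∀ i, IsTestFunctionOn Ω (φ i)) ∧
      ∀ (w : E' → F) (g : E' → E' →L[ℝ] F), HasWeakFDerivOn Ω μ w g →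
        eLpNorm w 2 (μ.restrict Ω) ^ 2 ≤
          ε * (eLpNorm w 2 (μ.restrict Ω) ^ 2 + eLpNorm g 2 (μ.restrict Ω) ^ 2) +
            ∑ i, ‖∫ x in (Ω : Set E'), φ i x • w x ∂μ‖ₑ ^ 2 := by
  obtain ⟨n, φ, hφ, h⟩ := ehrling_unit (F := F) hΩ hb μ hε
  refine ⟨n, φ, hφ, fun w g hw => ?_⟩
  set μΩ : Measure E' := μ.restrict (Ω : Set E') with hμΩ
  set a := eLpNorm w 2 μΩ with ha
  set b := eLpNorm g 2 μΩ with hb'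
  set P := ∑ i, ‖∫ x in (Ω : Set E'), φ i x • w x ∂μ‖ₑ ^ 2 with hP
  -- degenerate cases
  rcases eq_or_ne a ⊤ with hat | hat
  · have : ε * (a ^ 2 + b ^ 2) = ⊤ := by
      rw [hat, ENNReal.top_pow two_ne_zero, top_add, ENNReal.mul_top hε]
    rw [this, top_add]; exact le_top
  rcases eq_or_ne b ⊤ with hbt | hbt
  · have : ε * (a ^ 2 + b ^ 2) = ⊤ := by
      rw [hbt, ENNReal.top_pow two_ne_zero, add_top, ENNReal.mul_top hε]
    rw [this, top_add]; exact le_top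
  rcases eq_or_ne a 0 with ha0 | ha0
  · rw [ha0, zero_pow two_ne_zero]; exact zero_le
  -- scaling by `c = S^{-1/2}`, `S = a² + b²`
  set S := a ^ 2 + b ^ 2 with hS
  have hS0 : S ≠ 0 := by
    rw [hS]; exact fun h => ha0 (pow_eq_zero_iff two_ne_zero |>.1 (add_eq_zero.1 h).1)
  have hSt : S ≠ ⊤ := by
    rw [hS]; exact ENNReal.add_ne_top.2 ⟨ENNReal.pow_ne_top hat, ENNReal.pow_ne_top hbt⟩
  set s : ℝ≥0 := NNReal.sqrt S.toNNReal with hs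
  have hs0 : s ≠ 0 := by
    rw [hs]; exact fun h => hS0 (by
      have := NNReal.sqrt_eq_zero.1 h
      rwa [ENNReal.toNNReal_eq_zero_iff, or_iff_left hSt] at this)
  have hsS : (s : ℝ≥0∞) ^ 2 = S := by
    rw [hs, ← ENNReal.coe_pow, NNReal.sq_sqrt, ENNReal.coe_toNNReal hSt]
  set c : ℝ := (s : ℝ)⁻¹ with hc
  have hc0 : 0 < c := by rw [hc]; exact inv_pos.2 (NNReal.coe_pos.2 (pos_iff_ne_zero.2 hs0))
  have hce : ‖c‖ₑ = (s : ℝ≥0∞)⁻¹ := by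
    rw [hc, enorm_inv (NNReal.coe_ne_zero.2 hs0)]
    simp
  -- the scaled pair
  have hw' : HasWeakFDerivOn Ω μ (c • w) (c • g) := hw.const_smul c
  have ha' : eLpNorm (c • w) 2 μΩ = (s : ℝ≥0∞)⁻¹ * a := by
    have := eLpNorm_const_smul c w 2 μΩ
    rwa [hce] at this
  have hb'' : eLpNorm (c • g) 2 μΩ = (s : ℝ≥0∞)⁻¹ * b := by
    have := eLpNorm_const_smul c g 2 μΩ
    rwa [hce] at this
  have hle1 : ∀ {x : ℝ≥0∞}, x ^ 2 ≤ S → (s : ℝ≥0∞)⁻¹ * x ≤ 1 := by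
    intro x hx
    have hxs : x ≤ s := by
      have h1 : x ^ 2 ≤ (s : ℝ≥0∞) ^ 2 := by rwa [hsS]
      exact (ENNReal.pow_le_pow_left_iff two_ne_zero).1 h1
    calc (s : ℝ≥0∞)⁻¹ * x ≤ (s : ℝ≥0∞)⁻¹ * s := mul_le_mul' le_rfl hxs
      _ = 1 := ENNReal.inv_mul_cancel (by exact_mod_cast hs0) ENNReal.coe_ne_top
  have h1 : eLpNorm (c • w) 2 μΩ ≤ 1 := by rw [ha']; exact hle1 (by rw [hS]; exact le_self_add)
  have h2 : eLpNorm (c • g) 2 μΩ ≤ 1 := by rw [hb'']; exact hle1 (by rw [hS]; exact le_add_self)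
  have key := h (c • w) (c • g) hw' h1 h2
  -- unscale: the pairings scale by `c`
  have hPc : ∑ i, ‖∫ x in (Ω : Set E'), φ i x • (c • w) x ∂μ‖ₑ ^ 2 =
      (s : ℝ≥0∞)⁻¹ ^ 2 * P := by
    rw [hP, Finset.mul_sum]
    refine Finset.sum_congr rfl fun i _ => ?_
    have : ∫ x in (Ω : Set E'), φ i x • (c • w) x ∂μ = c • ∫ x in (Ω : Set E'), φ i x • w x ∂μ := by
      rw [← integral_smul]
      refine integral_congr_ae (Eventually.of_forall fun x => ?_)
      simp only [Pi.smul_apply, smul_comm (φ i x) c (w x)]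
    rw [this, enorm_smul, hce, mul_pow]
  rw [ha', hPc, mul_pow] at key
  -- multiply through by `s²`
  have hsi0 : (s : ℝ≥0∞)⁻¹ ^ 2 ≠ 0 := pow_ne_zero _ (ENNReal.inv_ne_zero.2 ENNReal.coe_ne_top)
  have hsit : (s : ℝ≥0∞)⁻¹ ^ 2 ≠ ⊤ :=
    ENNReal.pow_ne_top (ENNReal.inv_ne_top.2 (by exact_mod_cast hs0))
  have hinv : ((s : ℝ≥0∞)⁻¹ ^ 2)⁻¹ = S := by
    rw [ENNReal.inv_pow, inv_inv, hsS]
  calc a ^ 2 = ((s : ℝ≥0∞)⁻¹ ^ 2)⁻¹ * ((s : ℝ≥0∞)⁻¹ ^ 2 * a ^ 2) := by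
        rw [← mul_assoc, ENNReal.inv_mul_cancel hsi0 hsit, one_mul]
    _ ≤ ((s : ℝ≥0∞)⁻¹ ^ 2)⁻¹ * (ε + (s : ℝ≥0∞)⁻¹ ^ 2 * P) := mul_le_mul' le_rfl key
    _ = S * ε + P := by
        rw [mul_add, hinv, ← mul_assoc, ← hinv, ENNReal.inv_mul_cancel hsi0 hsit, one_mul]
    _ = ε * (a ^ 2 + b ^ 2) + P := by rw [hS, mul_comm]

/-- **Ehrling's lemma on a ball.** The case `Ω = B(x₀, R)` of `ehrling` (balls are bounded
Lipschitz domains, `isLipschitzDomain_ball`): for every `ε > 0` finitely many real test functions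
`φᵢ ∈ C_c^∞(B(x₀, R))` with
`‖w‖²_{L²(B)} ≤ ε (‖w‖²_{L²(B)} + ‖g‖²_{L²(B)}) + Σᵢ ‖∫_B φᵢ • w dμ‖²` for every `w` with weak
derivative `g` on the ball — the form used slice-wise in the compactness of weak solutions of the
Navier–Stokes equations on cylinders `(a, b) × B` (Temam 1977, Ch. III, Thm. 2.1; Lin 1998,
Thm. 2.2). [cite: Alt2016, E10.2 (Ehrling's lemma)] [cite: Temam1979, Ch. III §2 Lemma 2.1] -/
theorem ehrling_ball (x₀ : E') (R : ℝ) (μ : Measure E') [μ.IsAddHaarMeasure] {ε : ℝ≥0∞}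
    (hε : ε ≠ 0) :
    ∃ (n : ℕ) (φ : Fin n → E' → ℝ),
      (∀ i, IsTestFunctionOn (⟨ball x₀ R, isOpen_ball⟩ : Opens E') (φ i)) ∧
      ∀ (w : E' → F) (g : E' → E' →L[ℝ] F),
        HasWeakFDerivOn (⟨ball x₀ R, isOpen_ball⟩ : Opens E') μ w g →
        eLpNorm w 2 (μ.restrict (ball x₀ R)) ^ 2 ≤
          ε * (eLpNorm w 2 (μ.restrict (ball x₀ R)) ^ 2 +
            eLpNorm g 2 (μ.restrict (ball x₀ R)) ^ 2) +
            ∑ i, ‖∫ x in ball x₀ R, φ i x • w x ∂μ‖ₑ ^ 2 :=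
  ehrling (isLipschitzDomain_ball x₀ R) isBounded_ball μ hε

end Ehrling

end Literature.Analysis.FunctionSpaces
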